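import Mathlib
import Summits.Ventures.Crystal3D.Theorems.StickyWulffConstantTextureLiminfTentFrameWulff
import Summits.Ventures.Crystal3D.Theorems.StickyWulffConstantTextureLiminfTentBilayerTables
import Summits.Ventures.Crystal3D.Theorems.StickyWulffConstantTextureLiminfTexShadowCertificateDefs
import Summits.Ventures.Crystal3D.Theorems.StickyWulffConstantPolycrystalWulffBoundHyperplaneNull
import Literature.MathematicalPhysics.StatisticalMechanics.BarlowBilayers
import Literature.MathematicalPhysics.StatisticalMechanics.BarlowCoordination
import HarnessLib

/-!
# The tent certificate — bilayer frames of a moved Barlow stacking (eng g9)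

Route `StickyWulffConstant` (`Summits/Ventures/Crystal3D`, cell `crystal3d-full`), support toward the crux
`TextureLiminf` (stmt-Ventures-19483), line TexShadow v6.2, stub `stub_barlowFreeCertificate`, step (2′)/(3):
for a Hägg word `σ` and a frame `(L, s)`, every bilayer `i` of `stacking L s σ` is the image of the cubic
bilayer (sites of `(111)` layers `0, 1`) under a rigid motion `x ↦ T x + c` which carries the cubic slab
`cubicSlab 0` onto `laySlab L s i`, sends the two cubic layers to the two close-packed layers `i, i+1` (in one
of the two orders), and whose linear part `T` realises the Wulff body of EVERY fcc frame of that bilayer: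
`wulffOf A = T '' fccWulffBody` (`exists_bilayerMotion`; lit: `exists_motion_fccBilayer_zero_eq_moved`,
`BarlowBilayers.lean`, plus the frame uniqueness of `…TentFrameWulff.lean`).  Also: heights and layer planes of
the moved stacking (`height`), every point lies in an open layer slab or on a (null) layer plane, the slabs are
pairwise disjoint, and every atom touches only finitely many atoms (`BarlowCoordination.lean`).
WHAT THIS IS NOT: the certificate; F-C1 not moved.
-/

noncomputable section

namespace Summit.Ventures.Crystal3D.TentCertificate

open Finset Summit.Ventures.Crystal3D MeasureTheory
open Literature.Geometry.DiscreteGeometry (intVec intVec_apply)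
open Literature.MathematicalPhysics.StatisticalMechanics (fccStacking barlowStacking barlowPos barlowLayer
  constHagg IsHaggSeq fccWulffBody barlowPos_apply_two mem_barlowStacking_iff sep_barlowStacking_height
  exists_motion_fccBilayer_zero_eq_moved ncard_touching_eq_twelve)
open Summit.Ventures.Crystal3D.Cruxes.TextureLiminf.TexShadow (fccRef phiB wulffOf stacking bilayer laySlab)
open scoped RealInnerProductSpace

/-! ## Heights in the frame `(L, s)` -/

/-- The height (third Barlow coordinate) of a point in the frame `(L, s)`. -/
def height (L : E3 ≃ₗᵢ[ℝ] E3) (s : E3) (y : E3) : ℝ := (L.symm (y - s)) 2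

/-- The height of a moved point is its third coordinate. -/
theorem height_move (L : E3 ≃ₗᵢ[ℝ] E3) (s r : E3) : height L s (L r + s) = r 2 := by
  simp [height]

/-- A moved point is recovered from the frame. -/
theorem move_symm (L : E3 ≃ₗᵢ[ℝ] E3) (s y : E3) : L (L.symm (y - s)) + s = y := by
  simp

/-- Atoms of the moved stacking sit at integer heights. -/
theorem exists_height_eq_of_mem_stacking {L : E3 ≃ₗᵢ[ℝ] E3} {s : E3} {σ : ℤ → ℤ} {y : E3}
    (hy : y ∈ stacking L s σ) : ∃ k : ℤ, height L s y = k * hB := by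
  obtain ⟨r, hr, rfl⟩ := hy
  obtain ⟨k, i, j, rfl⟩ := mem_barlowStacking_iff.1 hr
  exact ⟨k, by rw [height_move, barlowPos_apply_two]⟩

/-- The bilayer is the moved pair of layers `i, i+1`. -/
theorem bilayer_eq_image (L : E3 ≃ₗᵢ[ℝ] E3) (s : E3) (σ : ℤ → ℤ) (i : ℤ) :
    bilayer L s σ i = (fun r => L r + s) '' (barlowLayer 1 hB σ i ∪ barlowLayer 1 hB σ (i + 1)) := by
  rw [bilayer, ← sep_barlowStacking_height hB_pos.ne' σ i]

/-- The bilayer lies in the stacking. -/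
theorem bilayer_subset_stacking (L : E3 ≃ₗᵢ[ℝ] E3) (s : E3) (σ : ℤ → ℤ) (i : ℤ) :
    bilayer L s σ i ⊆ stacking L s σ := by
  rintro _ ⟨r, ⟨hr, -⟩, rfl⟩; exact ⟨r, hr, rfl⟩

/-- Heights in a bilayer. -/
theorem height_of_mem_bilayer {L : E3 ≃ₗᵢ[ℝ] E3} {s : E3} {σ : ℤ → ℤ} {i : ℤ} {y : E3}
    (hy : y ∈ bilayer L s σ i) : height L s y = i * hB ∨ height L s y = (i + 1) * hB := by
  obtain ⟨r, ⟨-, hr⟩, rfl⟩ := hy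
  rw [height_move]; exact hr

/-- Membership in a layer slab by height. -/
theorem mem_laySlab_iff (L : E3 ≃ₗᵢ[ℝ] E3) (s : E3) (i : ℤ) (y : E3) :
    y ∈ laySlab L s i ↔ (i : ℝ) * hB < height L s y ∧ height L s y < ((i : ℝ) + 1) * hB := by
  constructor
  · rintro ⟨r, ⟨h1, h2⟩, rfl⟩; rw [height_move]; exact ⟨h1, h2⟩
  · rintro ⟨h1, h2⟩
    exact ⟨L.symm (y - s), ⟨h1, h2⟩, move_symm L s y⟩

/-- The layer slabs are pairwise disjoint. -/
theorem disjoint_laySlab (L : E3 ≃ₗᵢ[ℝ] E3) (s : E3) {i j : ℤ} (hij : i ≠ j) :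
    Disjoint (laySlab L s i) (laySlab L s j) := by
  rw [Set.disjoint_left]
  intro y hi hj
  rw [mem_laySlab_iff] at hi hj
  have hh := hB_pos
  rcases lt_or_gt_of_ne hij with h | h
  · have : (i : ℝ) + 1 ≤ j := by exact_mod_cast h
    nlinarith [hi.2, hj.1]
  · have : (j : ℝ) + 1 ≤ i := by exact_mod_cast h
    nlinarith [hj.2, hi.1]

/-- The layer slab is open. -/
theorem isOpen_laySlab (L : E3 ≃ₗᵢ[ℝ] E3) (s : E3) (i : ℤ) : IsOpen (laySlab L s i) := by
  have hc : Continuous (height L s) := by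
    unfold height
    exact (EuclideanSpace.proj (2 : Fin 3)).continuous.comp
      (L.symm.continuous.comp (continuous_id.sub continuous_const))
  have : laySlab L s i = height L s ⁻¹' Set.Ioo ((i : ℝ) * hB) (((i : ℝ) + 1) * hB) := by
    ext y; rw [mem_laySlab_iff]; rfl
  rw [this]; exact isOpen_Ioo.preimage hc

/-- **Every point off the layer planes lies in an open layer slab.** -/
theorem mem_laySlab_floor (L : E3 ≃ₗᵢ[ℝ] E3) (s : E3) {y : E3}
    (hy : ∀ k : ℤ, height L s y ≠ k * hB) : y ∈ laySlab L s ⌊height L s y / hB⌋ := by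
  rw [mem_laySlab_iff]
  have hh := hB_pos
  set z := height L s y / hB with hz
  have hzy : height L s y = z * hB := by rw [hz, div_mul_cancel₀ _ hh.ne']
  have h1 := Int.floor_le z
  have h2 := Int.lt_floor_add_one z
  have hne : (⌊z⌋ : ℝ) ≠ z := fun h => hy ⌊z⌋ (by rw [hzy, h])
  refine ⟨?_, ?_⟩
  · rw [hzy]; exact mul_lt_mul_of_pos_right (lt_of_le_of_ne h1 hne) hh
  · rw [hzy]; exact mul_lt_mul_of_pos_right h2 hh

/-- **A layer plane is Lebesgue-null.** -/
theorem volume_setOf_height_eq (L : E3 ≃ₗᵢ[ℝ] E3) (s : E3) (c : ℝ) :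
    volume {y : E3 | height L s y = c} = 0 := by
  have hset : {y : E3 | height L s y = c} =
      {y : E3 | ⟪L (EuclideanSpace.single 2 1), y⟫ = c + ⟪L (EuclideanSpace.single 2 1), s⟫} := by
    have key : ∀ v : E3, v 2 = ⟪EuclideanSpace.single 2 (1 : ℝ), v⟫ := fun v => by
      simp [EuclideanSpace.inner_single_left]
    ext y
    simp only [Set.mem_setOf_eq, height]
    rw [key, ← L.inner_map_map (EuclideanSpace.single 2 1) (L.symm (y - s)), L.apply_symm_apply,
      inner_sub_right]
    constructor <;> intro h <;> linarith
  rw [hset]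
  refine Summit.Ventures.Crystal3D.Theorems.volume_setOf_inner_eq_zero ?_ _
  rw [ne_eq, LinearIsometryEquiv.map_eq_zero_iff]
  intro h
  have := congrArg (fun v : E3 => v 2) h
  simp at this

/-- The layer planes together are null. -/
theorem volume_iUnion_planes (L : E3 ≃ₗᵢ[ℝ] E3) (s : E3) :
    volume (⋃ k : ℤ, {y : E3 | height L s y = k * hB}) = 0 :=
  (measure_iUnion_null_iff).2 fun _ => volume_setOf_height_eq L s _

/-! ## Finitely many touching atoms -/

/-- **An atom of the moved stacking touches finitely many atoms** (twelve). -/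
theorem finite_touching {L : E3 ≃ₗᵢ[ℝ] E3} {s : E3} {σ : ℤ → ℤ} (hσ : IsHaggSeq σ) {x : E3}
    (hx : x ∈ stacking L s σ) : {y | y ∈ stacking L s σ ∧ dist x y = 1}.Finite := by
  obtain ⟨r, hr, rfl⟩ := hx
  have h12 := ncard_touching_eq_twelve (a := 1) (h := hB) hσ one_pos (by rw [hB_sq]; norm_num) hr
  have hfin : {w | w ∈ barlowStacking 1 hB σ ∧ dist r w = 1}.Finite :=
    Set.finite_of_ncard_ne_zero (by rw [h12]; norm_num)
  refine (hfin.image fun w => L w + s).subset ?_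
  rintro y ⟨⟨w, hw, rfl⟩, hd⟩
  refine ⟨w, ⟨hw, ?_⟩, rfl⟩
  have : dist (L r + s) (L w + s) = dist r w := by
    rw [dist_add_right, L.dist_map]
  rwa [this] at hd

/-! ## Which layer goes where: the height function of a bilayer motion -/

/-- The origin is a point of fcc layer `0`. -/
theorem zero_mem_barlowLayer_zero : (0 : E3) ∈ barlowLayer 1 hB constHagg 0 :=
  ⟨0, 0, by simp [barlowPos]⟩

/-- **Layer heights of a bilayer motion.**  A rigid motion `r ↦ M r + c` carrying the fcc layers `0 ∪ 1` onto
the moved layers `k ∪ (k+1)` of the frame `(L, s)` and the open slab `(0, h)` onto the open slab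
`(k h, (k+1) h)` sends layer `0` to height `k h` and layer `1` to height `(k+1) h`, or the other way round. -/
theorem layer_heights_of_motion {σ : ℤ → ℤ} (L M : E3 ≃ₗᵢ[ℝ] E3) (s c : E3) (k : ℤ)
    (hlay : (fun r => M r + c) '' (barlowLayer 1 hB constHagg 0 ∪ barlowLayer 1 hB constHagg 1) =
      (fun r => L r + s) '' (barlowLayer 1 hB σ k ∪ barlowLayer 1 hB σ (k + 1)))
    (hslab : (fun r => M r + c) '' {r : E3 | 0 < r 2 ∧ r 2 < hB} =
      (fun r => L r + s) '' {r : E3 | (k : ℝ) * hB < r 2 ∧ r 2 < ((k : ℝ) + 1) * hB}) :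
    (∀ r ∈ barlowLayer 1 hB constHagg 0, height L s (M r + c) = k * hB) ∧
      (∀ r ∈ barlowLayer 1 hB constHagg 1, height L s (M r + c) = (k + 1) * hB) ∨
    (∀ r ∈ barlowLayer 1 hB constHagg 0, height L s (M r + c) = (k + 1) * hB) ∧
      (∀ r ∈ barlowLayer 1 hB constHagg 1, height L s (M r + c) = k * hB) := by
  have hh := hB_pos
  set e : E3 := EuclideanSpace.single 2 1 with he
  set lam : ℝ := (L.symm (M e)) 2 with hlam
  -- the height function of the motion is affine along `e`
  have haff : ∀ (r : E3) (t : ℝ), height L s (M (r + t • e) + c) = height L s (M r + c) + t * lam := by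
    intro r t
    simp only [height, map_add, map_smul, hlam]
    have : M r + t • M e + c - s = (M r + c - s) + t • M e := by abel
    rw [this, map_add, map_smul]
    simp
  -- values on the two layers and on the slab
  have hval : ∀ r ∈ barlowLayer 1 hB constHagg 0 ∪ barlowLayer 1 hB constHagg 1,
      height L s (M r + c) = k * hB ∨ height L s (M r + c) = (k + 1) * hB := by
    intro r hr
    have : M r + c ∈ (fun r => L r + s) '' (barlowLayer 1 hB σ k ∪ barlowLayer 1 hB σ (k + 1)) :=
      hlay ▸ ⟨r, hr, rfl⟩
    obtain ⟨r', hr', hre⟩ := this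
    rw [← hre, height_move]
    rcases hr' with ⟨i, j, rfl⟩ | ⟨i, j, rfl⟩
    · left; rw [barlowPos_apply_two]
    · right; rw [barlowPos_apply_two]; push_cast; ring
  have hsl : ∀ r : E3, 0 < r 2 → r 2 < hB →
      (k : ℝ) * hB < height L s (M r + c) ∧ height L s (M r + c) < ((k : ℝ) + 1) * hB := by
    intro r h1 h2
    have : M r + c ∈ (fun r => L r + s) '' {r : E3 | (k : ℝ) * hB < r 2 ∧ r 2 < ((k : ℝ) + 1) * hB} :=
      hslab ▸ ⟨r, ⟨h1, h2⟩, rfl⟩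
    obtain ⟨r', ⟨h1', h2'⟩, hre⟩ := this
    rw [← hre, height_move]; exact ⟨h1', h2'⟩
  have he2 : ∀ (r : E3) (t : ℝ), (r + t • e) 2 = r 2 + t := by
    intro r t; simp [he]
  have hl0 : ∀ r ∈ barlowLayer 1 hB constHagg 0, r 2 = 0 := by
    rintro r ⟨i, j, rfl⟩; rw [barlowPos_apply_two]; simp
  have hl1 : ∀ r ∈ barlowLayer 1 hB constHagg 1, r 2 = hB := by
    rintro r ⟨i, j, rfl⟩; rw [barlowPos_apply_two]; simp
  -- probes half a layer above layer 0 / below layer 1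
  have hup : ∀ r ∈ barlowLayer 1 hB constHagg 0,
      (k : ℝ) * hB < height L s (M r + c) + hB / 2 * lam ∧ height L s (M r + c) + hB / 2 * lam < ((k : ℝ) + 1) * hB := by
    intro r hr
    rw [← haff]
    exact hsl _ (by rw [he2, hl0 r hr]; linarith) (by rw [he2, hl0 r hr]; linarith)
  have hdn : ∀ r ∈ barlowLayer 1 hB constHagg 1,
      (k : ℝ) * hB < height L s (M r + c) + (-(hB / 2)) * lam ∧
        height L s (M r + c) + (-(hB / 2)) * lam < ((k : ℝ) + 1) * hB := by
    intro r hr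
    rw [← haff]
    exact hsl _ (by rw [he2, hl1 r hr]; linarith) (by rw [he2, hl1 r hr]; linarith)
  -- the sign of `lam` decides
  rcases hval 0 (Or.inl zero_mem_barlowLayer_zero) with h0 | h0
  · have hpos : 0 < lam := by
      have := (hup 0 zero_mem_barlowLayer_zero).1; rw [h0] at this; nlinarith
    left
    refine ⟨fun r hr => ?_, fun r hr => ?_⟩
    · rcases hval r (Or.inl hr) with h | h
      · exact h
      · have := (hup r hr).2; rw [h] at this; nlinarith
    · rcases hval r (Or.inr hr) with h | h
      · have := (hdn r hr).1; rw [h] at this; nlinarith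
      · exact h
  · have hneg : lam < 0 := by
      have := (hup 0 zero_mem_barlowLayer_zero).2; rw [h0] at this; nlinarith
    right
    refine ⟨fun r hr => ?_, fun r hr => ?_⟩
    · rcases hval r (Or.inl hr) with h | h
      · have := (hup r hr).1; rw [h] at this; nlinarith
      · exact h
    · rcases hval r (Or.inr hr) with h | h
      · exact h
      · have := (hdn r hr).2; rw [h] at this; nlinarith

/-! ## The bilayer motions -/

/-- `layer` of the frame file is `lay` of the tables file. -/
theorem layer_eq_lay (n : Site) : layer n = lay n := rfl

/-- **The bilayer motion.**  For a Hägg word `σ`, a frame `(L, s)` and a bilayer index `i` there are a linear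
isometry `T` (cubic coordinates → physical space), a vector `c` and a flag `swap` such that the rigid motion
`x ↦ T x + c`: maps the cubic sites of `(111)` layers `0, 1` ONTO `bilayer L s σ i`; maps the cubic slab
`cubicSlab 0` ONTO `laySlab L s i`; sends cubic layer `l ∈ {0,1}` to height `(i + l) h` (`swap = false`) or
`(i + 1 - l) h` (`swap = true`); and `T '' fccWulffBody` is the Wulff body `wulffOf A` of EVERY fcc frame
`(A, u)` with `bilayer L s σ i ⊆ A '' fccRef + u`. -/
theorem exists_bilayerMotion {σ : ℤ → ℤ} (hσ : IsHaggSeq σ) (L : E3 ≃ₗᵢ[ℝ] E3) (s : E3) (i : ℤ) :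
    ∃ (T : E3 ≃ₗᵢ[ℝ] E3) (c : E3) (swap : Bool),
      (∀ a : Site, (lay a = 0 ∨ lay a = 1) → T (site a) + c ∈ bilayer L s σ i) ∧
      (∀ y ∈ bilayer L s σ i, ∃ a : Site, (lay a = 0 ∨ lay a = 1) ∧ T (site a) + c = y) ∧
      ((fun x => T x + c) '' cubicSlab 0 = laySlab L s i) ∧
      (∀ a : Site, (lay a = 0 ∨ lay a = 1) →
        height L s (T (site a) + c) = ((i : ℝ) + (if swap then 1 - (lay a : ℝ) else (lay a : ℝ))) * hB) ∧
      (∀ (A : E3 ≃ₗᵢ[ℝ] E3) (u : E3), bilayer L s σ i ⊆ (fun r => A r + u) '' fccRef →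
        wulffOf A = T '' fccWulffBody) := by
  obtain ⟨M, c, hlay, hslab⟩ := exists_motion_fccBilayer_zero_eq_moved 1 hB hσ L s i
  have hbil := bilayer_eq_image L s σ i
  have htr : ∀ x : E3, (toRef.trans M) x = M (toRef x) := fun x => rfl
  -- cubic layers 0, 1 ↦ fcc reference layers 0, 1
  have href : ∀ a : Site, (lay a = 0 ∨ lay a = 1) →
      toRef (site a) ∈ barlowLayer 1 hB constHagg 0 ∪ barlowLayer 1 hB constHagg 1 := by
    intro a ha
    have h := toRef_site_mem_barlowLayer a
    rw [layer_eq_lay] at h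
    rcases ha with ha | ha
    · left; rwa [ha] at h
    · right; rw [ha] at h; simpa using h
  have cl1 : ∀ a : Site, (lay a = 0 ∨ lay a = 1) → (toRef.trans M) (site a) + c ∈ bilayer L s σ i := by
    intro a ha
    rw [hbil, ← hlay, htr]
    exact ⟨toRef (site a), href a ha, rfl⟩
  have cl2 : ∀ y ∈ bilayer L s σ i, ∃ a : Site, (lay a = 0 ∨ lay a = 1) ∧ (toRef.trans M) (site a) + c = y := by
    intro y hy
    rw [hbil, ← hlay] at hy
    obtain ⟨r, hr, rfl⟩ := hy
    rcases hr with hr | hr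
    · obtain ⟨n, hn, hnr⟩ := exists_site_of_mem_barlowLayer hr
      exact ⟨n, Or.inl (by rw [← layer_eq_lay]; exact hn), by rw [htr, hnr]⟩
    · obtain ⟨n, hn, hnr⟩ := exists_site_of_mem_barlowLayer hr
      exact ⟨n, Or.inr (by rw [← layer_eq_lay]; exact hn), by rw [htr, hnr]⟩
  have cl3 : (fun x => (toRef.trans M) x + c) '' cubicSlab 0 = laySlab L s i := by
    have hcomp : (fun x => (toRef.trans M) x + c) = (fun r => M r + c) ∘ toRef := by
      funext x; simp [htr]
    rw [hcomp, Set.image_comp, image_toRef_cubicSlab 0]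
    have : {r : E3 | ((0 : ℤ) : ℝ) * hB < r 2 ∧ r 2 < (((0 : ℤ) : ℝ) + 1) * hB} = {r : E3 | 0 < r 2 ∧ r 2 < hB} := by
      ext r; simp
    rw [this, hslab]
    rfl
  have cl5 : ∀ (A : E3 ≃ₗᵢ[ℝ] E3) (u : E3), bilayer L s σ i ⊆ (fun r => A r + u) '' fccRef →
      wulffOf A = (toRef.trans M) '' fccWulffBody := by
    intro A u hAu
    rw [← wulffOf_eq_image M]
    have hB' : (fun r => M r + c) '' (toRef '' (site '' {n : Site | layer n = 0 ∨ layer n = 1})) ⊆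
        (fun r => A r + u) '' fccRef := by
      rintro _ ⟨_, ⟨_, ⟨n, hn, rfl⟩, rfl⟩, rfl⟩
      refine hAu ?_
      have := cl1 n (by rw [← layer_eq_lay]; exact hn)
      rwa [htr] at this
    exact (wulffOf_eq_of_subset hB' unitVec_subset_sub).symm
  -- the heights decide the flag
  have hmem0 : ∀ a : Site, lay a = 0 → toRef (site a) ∈ barlowLayer 1 hB constHagg 0 := by
    intro a ha; have h := toRef_site_mem_barlowLayer a; rwa [layer_eq_lay, ha] at h
  have hmem1 : ∀ a : Site, lay a = 1 → toRef (site a) ∈ barlowLayer 1 hB constHagg 1 := by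
    intro a ha; have h := toRef_site_mem_barlowLayer a; rw [layer_eq_lay, ha] at h; simpa using h
  rcases layer_heights_of_motion L M s c i hlay hslab with ⟨h0, h1⟩ | ⟨h0, h1⟩
  · refine ⟨toRef.trans M, c, false, cl1, cl2, cl3, ?_, cl5⟩
    intro a ha
    rw [htr]
    rcases ha with ha | ha
    · rw [h0 _ (hmem0 a ha), ha]; simp
    · rw [h1 _ (hmem1 a ha), ha]; simp
  · refine ⟨toRef.trans M, c, true, cl1, cl2, cl3, ?_, cl5⟩
    intro a ha
    rw [htr]
    rcases ha with ha | ha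
    · rw [h0 _ (hmem0 a ha), ha]; simp
    · rw [h1 _ (hmem1 a ha), ha]; simp

end Summit.Ventures.Crystal3D.TentCertificate

end
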